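import Mathlib.Analysis.SpecialFunctions.Trigonometric.DerivHyp
import Literature.Probability.RandomPlanarGeometry.RectangleSCIntegrand
import HarnessLib

/-!
# The Schwarz–Christoffel map of the rectangle, IV: injectivity on `ℍₒ`

Fourth input of the proof of `rectangle_crossRatio_eq_elliptic` (Bollobás–Riordan (2006), Ch. 7
§7.1, p. 185): the Schwarz–Christoffel map `F_k = scrFun k` (`RectangleSCIntegrand.lean`) is
injective on `ℍₒ` for `0 ≤ k ≤ 1` (`scrFun_injOn`).

The printed proofs obtain this from the argument principle (the boundary is traversed once). As in
`SchwarzChristoffelTriangle.lean` we use instead the **Noshiro–Warschawski univalence criterion**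
(`Re G′ > 0` on a convex domain implies `G` injective), applied to `G = F_k ∘ sin` on the convex
half-strip `Σ = {|re θ| < π/2, im θ > 0}` (`scrHalfStrip`), which `sin` maps bijectively onto `ℍₒ`
(`sin_mem_upperHalfPlaneSet_of_mem`, `exists_mem_scrHalfStrip_sin_eq`; Mathlib's
`Complex.sin_surjective` and the formula `im sin (a+ib) = cos a sinh b`): by the chain rule
`G′(θ) = f_k(sin θ) cos θ = (cos²θ)^{-1/2} cos θ · (1 - k² sin²θ)^{-1/2} = (1 - k² sin²θ)^{-1/2}`
(`re cos θ > 0` on `Σ`, so `(cos²θ)^{-1/2} = (cos θ)⁻¹` for the principal branch), whose real part is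
positive because `1 - k² sin²θ` lies in the slit plane (`re_cpow_neg_half_pos`). This is the
classical substitution `t = sin θ` turning `∫ dt/√((1-t²)(1-k²t²))` into Legendre's form
`∫ dθ/√(1 - k² sin²θ)`.

## References

* B. Bollobás, O. Riordan, *Percolation*, CUP (2006), Ch. 7 §7.1, p. 185.
* K. Noshiro, *On the theory of schlicht functions*, J. Fac. Sci. Hokkaido Univ. 2 (1934) 129–155;
  S. E. Warschawski, *On the higher derivatives at the boundary in conformal mapping*,
  Trans. AMS 38 (1935) 310–340.
* Z. Nehari, *Conformal Mapping*, McGraw-Hill (1952), Ch. V §6.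
-/

open Set Filter Topology Complex MeasureTheory Metric
open scoped Real Interval ComplexConjugate
open UpperHalfPlane (upperHalfPlaneSet isOpen_upperHalfPlaneSet)

noncomputable section

namespace Literature.Probability.RandomPlanarGeometry

variable {k : ℝ}

/-! ### The half-strip `Σ = {|re θ| < π/2, im θ > 0}` and `sin : Σ → ℍₒ` -/

/-- The open half-strip `Σ = {θ | -π/2 < re θ < π/2, 0 < im θ}`, mapped by `sin` bijectively onto
`ℍₒ`. [folklore] -/
def scrHalfStrip : Set ℂ := {θ : ℂ | -(π / 2) < θ.re ∧ θ.re < π / 2 ∧ 0 < θ.im}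

/-- `im (sin θ) = cos (re θ) sinh (im θ)`. [folklore] -/
theorem sin_im_eq_cos_mul_sinh (θ : ℂ) : (Complex.sin θ).im = Real.cos θ.re * Real.sinh θ.im := by
  rw [Complex.sin_eq]
  simp [Complex.sin_ofReal_re, Complex.sin_ofReal_im, Complex.cos_ofReal_re, Complex.cos_ofReal_im,
    Complex.sinh_ofReal_re, Complex.sinh_ofReal_im, Complex.cosh_ofReal_re, Complex.cosh_ofReal_im]

/-- `re (cos θ) = cos (re θ) cosh (im θ)`. [folklore] -/
theorem cos_re_eq_cos_mul_cosh (θ : ℂ) : (Complex.cos θ).re = Real.cos θ.re * Real.cosh θ.im := by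
  rw [Complex.cos_eq]
  simp [Complex.sin_ofReal_re, Complex.sin_ofReal_im, Complex.cos_ofReal_re, Complex.cos_ofReal_im,
    Complex.sinh_ofReal_re, Complex.sinh_ofReal_im, Complex.cosh_ofReal_re, Complex.cosh_ofReal_im]

/-- `sin Σ ⊆ ℍₒ`. [folklore] -/
theorem sin_mem_upperHalfPlaneSet_of_mem {θ : ℂ} (hθ : θ ∈ scrHalfStrip) : Complex.sin θ ∈ upperHalfPlaneSet := by
  show 0 < (Complex.sin θ).im
  rw [sin_im_eq_cos_mul_sinh]
  exact mul_pos (Real.cos_pos_of_mem_Ioo ⟨hθ.1, hθ.2.1⟩) (Real.sinh_pos_iff.2 hθ.2.2)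

/-- `re (cos θ) > 0` on `Σ`. [folklore] -/
theorem cos_re_pos_of_mem {θ : ℂ} (hθ : θ ∈ scrHalfStrip) : 0 < (Complex.cos θ).re := by
  rw [cos_re_eq_cos_mul_cosh]
  exact mul_pos (Real.cos_pos_of_mem_Ioo ⟨hθ.1, hθ.2.1⟩) (Real.cosh_pos _)

/-- A point `θ` with `re θ ∈ [-π/2, π/2]` and `im (sin θ) > 0` lies in `Σ`. [folklore] -/
theorem mem_scrHalfStrip_of_re_mem_Icc {θ : ℂ} (hre : θ.re ∈ Icc (-(π / 2)) (π / 2))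
    (him : 0 < (Complex.sin θ).im) : θ ∈ scrHalfStrip := by
  rw [sin_im_eq_cos_mul_sinh] at him
  have hcos : 0 ≤ Real.cos θ.re := Real.cos_nonneg_of_mem_Icc hre
  have hcos' : 0 < Real.cos θ.re := by
    rcases hcos.eq_or_lt with h | h
    · rw [← h, zero_mul] at him; exact absurd him (lt_irrefl 0)
    · exact h
  have hsinh : 0 < Real.sinh θ.im := pos_of_mul_pos_right him hcos
  refine ⟨?_, ?_, Real.sinh_pos_iff.1 hsinh⟩
  · rcases hre.1.eq_or_lt with h | h
    · exfalso; rw [← h, Real.cos_neg, Real.cos_pi_div_two] at hcos'; exact lt_irrefl 0 hcos'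
    · exact h
  · rcases hre.2.eq_or_lt with h | h
    · exfalso; rw [h, Real.cos_pi_div_two] at hcos'; exact lt_irrefl 0 hcos'
    · exact h

/-- **`sin : Σ → ℍₒ` is onto**: every point of `ℍₒ` is `sin θ` for some `θ ∈ Σ` (from
`Complex.sin_surjective`, `2π`-periodicity and `sin (π - θ) = sin θ`). [folklore] -/
theorem exists_mem_scrHalfStrip_sin_eq {w : ℂ} (hw : w ∈ upperHalfPlaneSet) :
    ∃ θ ∈ scrHalfStrip, Complex.sin θ = w := by
  have hw' : (0 : ℝ) < w.im := hw
  obtain ⟨θ₀, hθ₀⟩ := Complex.sin_surjective w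
  -- normalise the real part into `[-π/2, 3π/2)`
  set n : ℤ := toIcoDiv Real.two_pi_pos (-(π / 2)) θ₀.re with hn
  set θ₁ : ℂ := θ₀ - (n : ℂ) * (2 * π) with hθ₁
  have hθ₁re : θ₁.re ∈ Ico (-(π / 2)) (-(π / 2) + 2 * π) := by
    have h := sub_toIcoDiv_zsmul_mem_Ico Real.two_pi_pos (-(π / 2)) θ₀.re
    rw [← hn, zsmul_eq_mul] at h
    have : θ₁.re = θ₀.re - n * (2 * π) := by simp [hθ₁]
    rwa [this]
  have hsin₁ : Complex.sin θ₁ = w := by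
    rw [hθ₁, ← hθ₀]
    exact Complex.sin_periodic.sub_int_mul_eq n
  by_cases hcase : θ₁.re ≤ π / 2
  · refine ⟨θ₁, mem_scrHalfStrip_of_re_mem_Icc ⟨hθ₁re.1, hcase⟩ (by rwa [hsin₁]), hsin₁⟩
  · refine ⟨π - θ₁, mem_scrHalfStrip_of_re_mem_Icc ⟨?_, ?_⟩ ?_, ?_⟩
    · simp; linarith [hθ₁re.2]
    · simp; linarith [not_le.1 hcase]
    · rw [Complex.sin_pi_sub, hsin₁]; exact hw'
    · rw [Complex.sin_pi_sub, hsin₁]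

/-! ### The real part of a principal power `z^{-1/2}` -/

/-- For `z` in the slit plane, `re (z^{-1/2}) > 0` (`arg (z^{-1/2}) = -arg z / 2 ∈ (-π/2, π/2)`). [folklore] -/
theorem re_cpow_neg_half_pos {z : ℂ} (hz : z ∈ slitPlane) : 0 < (z ^ (-(1 / 2 : ℂ))).re := by
  have hz0 : z ≠ 0 := slitPlane_ne_zero hz
  have harg : z.arg ≠ π := slitPlane_arg_ne_pi hz
  rw [cpow_def_of_ne_zero hz0, exp_re, neg_half_eq_cast]
  refine mul_pos (Real.exp_pos _) ?_
  have him : (log z * ((-(1 / 2) : ℝ) : ℂ)).im = -(arg z / 2) := by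
    simp only [mul_im, ofReal_re, ofReal_im, mul_zero, zero_add, log_im]; ring
  rw [him, Real.cos_neg]
  refine Real.cos_pos_of_mem_Ioo ⟨?_, ?_⟩
  · linarith [neg_pi_lt_arg z]
  · linarith [lt_of_le_of_ne (arg_le_pi z) harg]

/-- For `c` with `re c > 0`: `(c²)^{-1/2} c = 1` (principal branch; `arg c ∈ (-π/2, π/2)` so
`(c·c)^{-1/2} = c^{-1/2} c^{-1/2} = c⁻¹`). [folklore] -/
theorem sq_cpow_neg_half_mul_self {c : ℂ} (hc : 0 < c.re) : (c ^ 2) ^ (-(1 / 2 : ℂ)) * c = 1 := by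
  have hc0 : c ≠ 0 := fun h => by rw [h] at hc; simp at hc
  have harg : |arg c| < π / 2 := abs_arg_lt_pi_div_two_iff.2 (Or.inl hc)
  have harg' : arg c + arg c ∈ Ioc (-π) π := by
    rw [abs_lt] at harg
    exact ⟨by linarith [harg.1], by linarith [harg.2]⟩
  rw [sq, mul_cpow_of_arg hc0 hc0 harg' _, ← cpow_add _ _ hc0,
    show -(1 / 2 : ℂ) + -(1 / 2 : ℂ) = -1 by norm_num, cpow_neg_one, inv_mul_cancel₀ hc0]

/-! ### `G = F_k ∘ sin` on `Σ`: `G′ = (1 - k² sin²θ)^{-1/2}` has positive real part -/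

/-- For `θ ∈ Σ` and `0 ≤ k ≤ 1`, `1 - (k sin θ)²` lies in the slit plane. [folklore] -/
theorem one_sub_mul_sin_sq_mem_slitPlane (hk0 : 0 ≤ k) (hk1 : k ≤ 1) {θ : ℂ} (hθ : θ ∈ scrHalfStrip) :
    1 - ((k : ℂ) * Complex.sin θ) ^ 2 ∈ slitPlane :=
  one_sub_mul_sq_mem_slitPlane hk0 hk1 (upperHalfPlaneSet_subset_scrDomain (sin_mem_upperHalfPlaneSet_of_mem hθ))

/-- **The derivative of `G = F_k ∘ sin` on `Σ`**: `G′(θ) = f_k(sin θ) cos θ = (1 - k² sin²θ)^{-1/2}`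
(Legendre's form of the elliptic integrand). [folklore] -/
theorem hasDerivAt_scrFun_sin (hk0 : 0 ≤ k) (hk1 : k ≤ 1) {θ : ℂ} (hθ : θ ∈ scrHalfStrip) :
    HasDerivAt (fun θ => scrFun k (Complex.sin θ)) ((1 - ((k : ℂ) * Complex.sin θ) ^ 2) ^ (-(1 / 2 : ℂ))) θ := by
  have hsin := sin_mem_upperHalfPlaneSet_of_mem hθ
  have h := (hasDerivAt_scrFun_of_mem hk0 hk1 hsin).comp θ (Complex.hasDerivAt_sin θ)
  refine h.congr_deriv ?_
  rw [scrDeriv, ← Complex.cos_sq']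
  calc (Complex.cos θ ^ 2) ^ (-(1 / 2 : ℂ)) * (1 - ((k : ℂ) * Complex.sin θ) ^ 2) ^ (-(1 / 2 : ℂ)) * Complex.cos θ
      = (1 - ((k : ℂ) * Complex.sin θ) ^ 2) ^ (-(1 / 2 : ℂ)) *
          ((Complex.cos θ ^ 2) ^ (-(1 / 2 : ℂ)) * Complex.cos θ) := by ring
    _ = _ := by rw [sq_cpow_neg_half_mul_self (cos_re_pos_of_mem hθ), mul_one]

/-- `re G′ > 0` on `Σ`. [folklore] -/
theorem re_deriv_scrFun_sin_pos (hk0 : 0 ≤ k) (hk1 : k ≤ 1) {θ : ℂ} (hθ : θ ∈ scrHalfStrip) :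
    0 < ((1 - ((k : ℂ) * Complex.sin θ) ^ 2) ^ (-(1 / 2 : ℂ))).re :=
  re_cpow_neg_half_pos (one_sub_mul_sin_sq_mem_slitPlane hk0 hk1 hθ)

/-- `Σ` is convex: segments between points of `Σ` stay in `Σ`. [folklore] -/
theorem segment_mem_scrHalfStrip {θ₁ θ₂ : ℂ} (h₁ : θ₁ ∈ scrHalfStrip) (h₂ : θ₂ ∈ scrHalfStrip) {t : ℝ}
    (ht : t ∈ Icc (0 : ℝ) 1) : θ₁ + (t : ℂ) * (θ₂ - θ₁) ∈ scrHalfStrip := by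
  obtain ⟨a1, b1, c1⟩ := h₁
  obtain ⟨a2, b2, c2⟩ := h₂
  simp only [scrHalfStrip, mem_setOf_eq, add_re, mul_re, ofReal_re, sub_re, ofReal_im, sub_im,
    zero_mul, sub_zero, add_im, mul_im, add_zero]
  refine ⟨?_, ?_, ?_⟩
  · nlinarith [mul_nonneg (sub_nonneg.2 ht.2) (sub_nonneg.2 (min_le_left θ₁.re θ₂.re)),
      mul_nonneg ht.1 (sub_nonneg.2 (min_le_right θ₁.re θ₂.re)), lt_min a1 a2]
  · nlinarith [mul_nonneg (sub_nonneg.2 ht.2) (sub_nonneg.2 (le_max_left θ₁.re θ₂.re)),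
      mul_nonneg ht.1 (sub_nonneg.2 (le_max_right θ₁.re θ₂.re)), max_lt b1 b2]
  · nlinarith [mul_nonneg (sub_nonneg.2 ht.2) (sub_nonneg.2 (min_le_left θ₁.im θ₂.im)),
      mul_nonneg ht.1 (sub_nonneg.2 (min_le_right θ₁.im θ₂.im)), lt_min c1 c2]

/-- **Noshiro–Warschawski for `G = F_k ∘ sin`.** On the convex half-strip `Σ`, `re G′ > 0`, hence
`G` is injective: along the segment from `θ₁` to `θ₂` the real function
`t ↦ re (G(γ(t)) / (θ₂ - θ₁))` has positive derivative. [folklore] -/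
theorem scrFun_sin_injOn (hk0 : 0 ≤ k) (hk1 : k ≤ 1) : InjOn (fun θ => scrFun k (Complex.sin θ)) scrHalfStrip := by
  intro θ₁ h₁ θ₂ h₂ heq
  have heq' : scrFun k (Complex.sin θ₁) = scrFun k (Complex.sin θ₂) := heq
  by_contra hne
  set d : ℂ := θ₂ - θ₁ with hd
  have hd0 : d ≠ 0 := sub_ne_zero.2 (Ne.symm hne)
  set c : ℂ := d⁻¹ with hc
  have hγ : ∀ t ∈ Icc (0 : ℝ) 1, θ₁ + (t : ℂ) * d ∈ scrHalfStrip := fun t ht =>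
    segment_mem_scrHalfStrip h₁ h₂ ht
  have hderiv : ∀ t ∈ Icc (0 : ℝ) 1,
      HasDerivAt (fun x : ℝ => (c * scrFun k (Complex.sin (θ₁ + (x : ℂ) * d))).re)
        ((1 - ((k : ℂ) * Complex.sin (θ₁ + (t : ℂ) * d)) ^ 2) ^ (-(1 / 2 : ℂ))).re t := by
    intro t ht
    have hlin : HasDerivAt (fun z : ℂ => θ₁ + z * d) d (t : ℂ) := by
      simpa using ((hasDerivAt_id (t : ℂ)).mul_const d).const_add θ₁
    have hG := (hasDerivAt_scrFun_sin hk0 hk1 (hγ t ht)).comp (t : ℂ) hlin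
    have hf := hG.const_mul c
    have hval : c * ((1 - ((k : ℂ) * Complex.sin (θ₁ + (t : ℂ) * d)) ^ 2) ^ (-(1 / 2 : ℂ)) * d) =
        (1 - ((k : ℂ) * Complex.sin (θ₁ + (t : ℂ) * d)) ^ 2) ^ (-(1 / 2 : ℂ)) := by
      rw [hc]; field_simp
    rw [hval] at hf
    exact hf.real_of_complex
  have hcont : ContinuousOn (fun x : ℝ => (c * scrFun k (Complex.sin (θ₁ + (x : ℂ) * d))).re) (Icc 0 1) :=
    fun t ht => (hderiv t ht).continuousAt.continuousWithinAt
  have hmono := strictMonoOn_of_deriv_pos (convex_Icc 0 1) hcont (fun t ht => by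
    rw [interior_Icc] at ht
    rw [(hderiv t ⟨ht.1.le, ht.2.le⟩).deriv]
    exact re_deriv_scrFun_sin_pos hk0 hk1 (hγ t ⟨ht.1.le, ht.2.le⟩))
  have hlt := hmono (left_mem_Icc.2 zero_le_one) (right_mem_Icc.2 zero_le_one) zero_lt_one
  have e1 : θ₁ + ((1 : ℝ) : ℂ) * d = θ₂ := by rw [hd]; push_cast; ring
  have e0 : θ₁ + ((0 : ℝ) : ℂ) * d = θ₁ := by push_cast; ring
  simp only [e1, e0, heq'] at hlt
  exact lt_irrefl _ hlt

/-- **Injectivity of the Schwarz–Christoffel map of the rectangle on `ℍₒ`** (`F_k = G ∘ arcsin`;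
`0 ≤ k ≤ 1`). [cite: BollobasRiordan2006, Ch. 7 §7.1 p. 185] -/
theorem scrFun_injOn (hk0 : 0 ≤ k) (hk1 : k ≤ 1) : InjOn (scrFun k) upperHalfPlaneSet := by
  intro w₁ hw₁ w₂ hw₂ heq
  obtain ⟨θ₁, hθ₁, rfl⟩ := exists_mem_scrHalfStrip_sin_eq hw₁
  obtain ⟨θ₂, hθ₂, rfl⟩ := exists_mem_scrHalfStrip_sin_eq hw₂
  rw [scrFun_sin_injOn hk0 hk1 hθ₁ hθ₂ heq]

end Literature.Probability.RandomPlanarGeometry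

end
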